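import Summits.KontsevichZagierPeriods.KontsevichZagierPeriods.Theorems.HurwitzMicroSectorsNormalFormPrincipleLevelOne
import Summits.KontsevichZagierPeriods.KontsevichZagierPeriods.Theorems.HurwitzMicroSectorsNormalFormPrincipleSlabASubPtK20
import Summits.KontsevichZagierPeriods.KontsevichZagierPeriods.Theorems.HurwitzMicroSectorsNormalFormPrincipleAlgCarriers
import Summits.KontsevichZagierPeriods.KontsevichZagierPeriods.Theorems.HurwitzMicroSectorsNormalFormPrincipleM2FiveZetaTwo
import Summits.KontsevichZagierPeriods.KontsevichZagierPeriods.Theorems.AperySectorThreeTwo.Negative.Kit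

/-!
# `NormalFormPrinciple` (stmt-KontsevichZagierPeriods-3869), line `SketchIdeator1` — leaf `stub_boxRigidity`:
# weight three, level `K`, totally off resonance: the box and the merged band representations exist

Registered sub-goal `exists_reps3_box_band` of the layer `Weight3` (weight three, level `K ≥ 1`,
totally off resonance: the boxes `[(0,1)³, c·x^A y^B z^D/(1 − x^K y^K z^K)]`). For a real
algebraic coefficient `c` (`IsAlgebraic ℚ c`) the first two shapes of honest Kontsevich–Zagier
integral representations met along the weight-three pipeline exist, with LITERAL domains and
integrands:

* the level-`K` monomial box `[(0,1)³, c·x₀^A x₁^B x₂^D/(1 − x₀^K x₁^K x₂^K)]`: `ℚ`-semialgebraic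
  as the product of the algebraic constant `c` (`isSemialgebraicFunOn_const_of_isAlgebraic`) and a
  quotient of `ℚ`-polynomials (`1 − x₀^K x₁^K x₂^K > 0` on the box); absolutely convergent by
  DOMINATION: on the box `0 < 1 − x₀x₁x₂ ≤ 1 − (x₀x₁x₂)^K` and `x₀^A x₁^B x₂^D ≤ 1`, so the
  integrand is bounded in absolute value by `|c|/(1 − x₀x₁x₂)`, integrable on the open box by the
  tree's `BoxIntegral.integrableOn_box_one_div_one_sub_prod` (`∫_{(0,1)³} dx/(1 − x₀x₁x₂) = ζ(3)`);
* the merged band `[{(z₀,z₁) ∈ (0,1)², 0 ≤ z₂ ≤ z₀z₁}, c·z₀^{A'} z₁^{B'} z₂^D/(1 − z₂^K)]` — the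
  image of the box under the merge gadget `t = x₀x₁x₂` (rule 2) — `ℚ`-semialgebraic for the same
  reason (`1 − z₂^K ≥ 1 − z₂ ≥ 1 − z₀z₁ > 0` on the band); absolutely convergent by Tonelli along
  the fibre (`integrableOn_band_of_norm_le`): on the fibre over `(z₀,z₁)` the integrand is bounded
  by `|c|/(1 − z₀z₁)`, the fibre has length `z₀z₁ ≤ 1`, and `|c|/(1 − z₀z₁)` is integrable on
  `(0,1)²` (Beukers' integral for `ζ(2)`, again
  `BoxIntegral.integrableOn_box_one_div_one_sub_prod`).

References: M. Kontsevich, D. Zagier, *Periods* (2001), §1.1–1.2; F. Beukers, *A note on the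
irrationality of ζ(2) and ζ(3)*, Bull. LMS 11 (1979). No new definitions.
-/

noncomputable section

open MeasureTheory Set
open Literature.NumberTheory.Transcendental Literature.NumberTheory.Transcendental.KZ
open Literature.ModelTheory.ExponentialFields (IsSemialgebraic)

namespace Summit.KontsevichZagierPeriods.HurwitzMicroSectors.NormalFormPrinciple.PiBox.Weight3

/-! ## The level-`K` monomial box in dimension three -/

/-- On the open unit box of `ℝ³` the level-`K` denominator (`K ≥ 1`) dominates the level-one
denominator: `0 < 1 − x₀x₁x₂ ≤ 1 − x₀^K x₁^K x₂^K` (since `0 < x₀x₁x₂ < 1` gives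
`(x₀x₁x₂)^K ≤ x₀x₁x₂`), and the monomial `x₀^A x₁^B x₂^D` lies in `[0,1]`. [folklore] -/
theorem w3_box3_bounds {K : ℕ} (hK : 0 < K) (A B D : ℕ) {x : Fin 3 → ℝ}
    (hx : ∀ i, x i ∈ Set.Ioo (0:ℝ) 1) :
    (0 < 1 - x 0 * x 1 * x 2 ∧ 1 - x 0 * x 1 * x 2 ≤ 1 - x 0 ^ K * x 1 ^ K * x 2 ^ K) ∧
      0 ≤ x 0 ^ A * x 1 ^ B * x 2 ^ D ∧ x 0 ^ A * x 1 ^ B * x 2 ^ D ≤ 1 := by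
  have h0 := hx 0
  have h1 := hx 1
  have h2 := hx 2
  have hp : x 0 * x 1 * x 2 ∈ Set.Ioo (0:ℝ) 1 :=
    Summit.KontsevichZagierPeriods.Theorems.AperySectorThreeTwo.Negative.prod_mem_Ioo hx
  have hpow : (x 0 * x 1 * x 2) ^ K ≤ x 0 * x 1 * x 2 := pow_le_of_le_one hp.1.le hp.2.le hK.ne'
  rw [mul_pow, mul_pow] at hpow
  refine ⟨⟨sub_pos.2 hp.2, by linarith⟩,
    mul_nonneg (mul_nonneg (pow_nonneg h0.1.le A) (pow_nonneg h1.1.le B)) (pow_nonneg h2.1.le D),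
    mul_le_one₀ (mul_le_one₀ (pow_le_one₀ h0.1.le h0.2.le) (pow_nonneg h1.1.le B)
      (pow_le_one₀ h1.1.le h1.2.le)) (pow_nonneg h2.1.le D) (pow_le_one₀ h2.1.le h2.2.le)⟩

/-- **Semialgebraicity of the weight-three level-`K` monomial integrand with an algebraic
coefficient.** `x ↦ c·x₀^A x₁^B x₂^D/(1 − x₀^K x₁^K x₂^K)` (`K ≥ 1`) is `ℚ`-semialgebraic on the
open unit box of `ℝ³` for real algebraic `c`: the constant `c` is `ℚ`-semialgebraic
(`isSemialgebraicFunOn_const_of_isAlgebraic`) and so is the quotient of `ℚ`-polynomials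
`x₀^A x₁^B x₂^D/(1 − x₀^K x₁^K x₂^K)`, whose denominator is positive on the box.
[cite: KontsevichZagier2001, §1.1] -/
theorem w3_isSemialgebraicFunOn_box3Integrand {K : ℕ} (hK : 0 < K) (A B D : ℕ) {c : ℝ}
    (hc : IsAlgebraic ℚ c) :
    IsSemialgebraicFunOn ℚ {x : Fin 3 → ℝ | ∀ i, x i ∈ Set.Ioo (0:ℝ) 1}
      (fun x => c * (x 0 ^ A * x 1 ^ B * x 2 ^ D) / (1 - x 0 ^ K * x 1 ^ K * x 2 ^ K)) := by
  refine (IsSemialgebraicFunOn.mul_holds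
    (isSemialgebraicFunOn_const_of_isAlgebraic (isSemialgebraic_box 3) hc)
    (isSemialgebraicFunOn_aeval_div_aeval (isSemialgebraic_box 3)
      (MvPolynomial.X 0 ^ A * MvPolynomial.X 1 ^ B * MvPolynomial.X 2 ^ D)
      (1 - MvPolynomial.X 0 ^ K * MvPolynomial.X 1 ^ K * MvPolynomial.X 2 ^ K)
      fun x hx => ?_)).congr fun x _ => ?_
  · have h := (w3_box3_bounds hK A B D hx).1
    simp only [map_sub, map_one, map_mul, map_pow, MvPolynomial.aeval_X]
    exact (h.1.trans_le h.2).ne'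
  · simp only [Pi.mul_apply, map_sub, map_one, map_mul, map_pow, MvPolynomial.aeval_X]
    ring

/-- **Absolute convergence of the weight-three level-`K` monomial integrand with a real
coefficient** (`K ≥ 1`): `c·x₀^A x₁^B x₂^D/(1 − x₀^K x₁^K x₂^K)` is integrable on the open unit box
of `ℝ³` — it is measurable and dominated in absolute value by `|c|/(1 − x₀x₁x₂)`
(`0 < 1 − x₀x₁x₂ ≤ 1 − x₀^K x₁^K x₂^K`, `x₀^A x₁^B x₂^D ≤ 1`), which is integrable by Beukers'
triple integral for `ζ(3)` (the tree's `BoxIntegral.integrableOn_box_one_div_one_sub_prod`).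
[cite: KontsevichZagier2001, §1.1] -/
theorem w3_integrableOn_box3Integrand {K : ℕ} (hK : 0 < K) (A B D : ℕ) (c : ℝ) :
    IntegrableOn (fun x : Fin 3 → ℝ => c * (x 0 ^ A * x 1 ^ B * x 2 ^ D) /
      (1 - x 0 ^ K * x 1 ^ K * x 2 ^ K)) {x | ∀ i, x i ∈ Set.Ioo (0:ℝ) 1} := by
  have hA : MeasurableSet {x : Fin 3 → ℝ | ∀ i, x i ∈ Set.Ioo (0:ℝ) 1} :=
    Beukers.measurableSet_cube 3
  have h1 : IntegrableOn (fun x : Fin 3 → ℝ => |c| * (1 / (1 - ∏ i, x i)))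
      {x | ∀ i, x i ∈ Set.Ioo (0:ℝ) 1} :=
    (BoxIntegral.integrableOn_box_one_div_one_sub_prod (n := 3) (by norm_num)).const_mul |c|
  refine Integrable.mono' h1 (Measurable.aestronglyMeasurable (by fun_prop))
    (ae_restrict_of_forall_mem hA fun x hx => ?_)
  have hb := w3_box3_bounds hK A B D hx
  rw [Fin.prod_univ_three, Real.norm_eq_abs, abs_div, abs_mul, abs_of_pos (hb.1.1.trans_le hb.1.2),
    abs_of_nonneg hb.2.1, mul_div_assoc]
  exact mul_le_mul_of_nonneg_left (div_le_div₀ zero_le_one hb.2.2 hb.1.1 hb.1.2) (abs_nonneg c)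

/-- **The weight-three level-`K` monomial box with an algebraic coefficient exists** (`K ≥ 1`):
`[(0,1)³, c·x₀^A x₁^B x₂^D/(1 − x₀^K x₁^K x₂^K)]` is an integral representation for real algebraic
`c`. [cite: KontsevichZagier2001, §1.1] -/
theorem w3_exists_box3Rep {K : ℕ} (hK : 0 < K) (A B D : ℕ) {c : ℝ} (hc : IsAlgebraic ℚ c) :
    ∃ N : IntegralRep 3, N.domain = {x | ∀ i, x i ∈ Set.Ioo (0:ℝ) 1} ∧
      N.integrand = fun x => c * (x 0 ^ A * x 1 ^ B * x 2 ^ D) /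
        (1 - x 0 ^ K * x 1 ^ K * x 2 ^ K) :=
  ⟨⟨_, _, isSemialgebraic_box 3, w3_isSemialgebraicFunOn_box3Integrand hK A B D hc,
    w3_integrableOn_box3Integrand hK A B D c⟩, rfl, rfl⟩

/-! ## The merged band over `(0,1)²` with fibre `[0, z₀z₁]` -/

/-- The merged band `{(z₀,z₁) ∈ (0,1)², 0 ≤ z₂ ≤ z₀z₁}` is `ℚ`-semialgebraic (a band over the
open unit box of `ℝ²` with polynomial edges `0` and `y₀y₁`; Tarski–Seidenberg).
[cite: KontsevichZagier2001, §1.1] -/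
theorem w3_isSemialgebraic_mergedBand :
    IsSemialgebraic ℚ (KZlog.band {y : Fin 2 → ℝ | ∀ i, y i ∈ Set.Ioo (0:ℝ) 1} (fun _ => (0:ℝ))
      (fun y => y 0 * y 1)) :=
  KZlog.isSemialgebraic_band (by simpa using isSemialgebraicFunOn_ratCast (isSemialgebraic_box 2) 0)
    ((isSemialgebraicFunOn_aeval (isSemialgebraic_box 2)
      (MvPolynomial.X 0 * MvPolynomial.X 1)).congr fun y _ => by simp)

/-- On the merged band `{(z₀,z₁) ∈ (0,1)², 0 ≤ z₂ ≤ z₀z₁}` the level-`K` denominator (`K ≥ 1`)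
dominates `1 − z₀z₁`: `0 < 1 − z₀z₁ ≤ 1 − z₂^K` (since `0 ≤ z₂ ≤ z₀z₁ < 1` gives
`z₂^K ≤ z₂ ≤ z₀z₁`), and the monomial `z₀^{A'} z₁^{B'} z₂^D` lies in `[0,1]`. [folklore] -/
theorem w3_mergedBand_bounds {K : ℕ} (hK : 0 < K) (A' B' D : ℕ) {z : Fin 3 → ℝ}
    (hz : z ∈ KZlog.band {y : Fin 2 → ℝ | ∀ i, y i ∈ Set.Ioo (0:ℝ) 1} (fun _ => (0:ℝ))
      (fun y => y 0 * y 1)) :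
    (0 < 1 - z 0 * z 1 ∧ 1 - z 0 * z 1 ≤ 1 - z 2 ^ K) ∧
      0 ≤ z 0 ^ A' * z 1 ^ B' * z 2 ^ D ∧ z 0 ^ A' * z 1 ^ B' * z 2 ^ D ≤ 1 := by
  have h : (∀ i, Fin.init z i ∈ Set.Ioo (0:ℝ) 1) ∧ 0 ≤ z 2 ∧ z 2 ≤ z 0 * z 1 := hz
  have h0 : z 0 ∈ Set.Ioo (0:ℝ) 1 := h.1 0
  have h1 : z 1 ∈ Set.Ioo (0:ℝ) 1 := h.1 1
  have hlt : z 0 * z 1 < 1 := mul_lt_one_of_nonneg_of_lt_one_left h0.1.le h0.2 h1.2.le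
  have h2 : z 2 < 1 := h.2.2.trans_lt hlt
  have hpow : z 2 ^ K ≤ z 2 := pow_le_of_le_one h.2.1 h2.le hK.ne'
  refine ⟨⟨sub_pos.2 hlt, by linarith [h.2.2]⟩,
    mul_nonneg (mul_nonneg (pow_nonneg h0.1.le A') (pow_nonneg h1.1.le B')) (pow_nonneg h.2.1 D),
    mul_le_one₀ (mul_le_one₀ (pow_le_one₀ h0.1.le h0.2.le) (pow_nonneg h1.1.le B')
      (pow_le_one₀ h1.1.le h1.2.le)) (pow_nonneg h.2.1 D) (pow_le_one₀ h.2.1 h2.le)⟩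

/-- **Semialgebraicity of the merged band integrand with an algebraic coefficient.**
`z ↦ c·z₀^{A'} z₁^{B'} z₂^D/(1 − z₂^K)` (`K ≥ 1`) is `ℚ`-semialgebraic on the merged band
`{(z₀,z₁) ∈ (0,1)², 0 ≤ z₂ ≤ z₀z₁}` for real algebraic `c`: the algebraic constant times a
quotient of `ℚ`-polynomials whose denominator `1 − z₂^K ≥ 1 − z₀z₁ > 0` does not vanish there.
[cite: KontsevichZagier2001, §1.1] -/
theorem w3_isSemialgebraicFunOn_mergedBandIntegrand {K : ℕ} (hK : 0 < K) (A' B' D : ℕ) {c : ℝ}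
    (hc : IsAlgebraic ℚ c) :
    IsSemialgebraicFunOn ℚ
      (KZlog.band {y : Fin 2 → ℝ | ∀ i, y i ∈ Set.Ioo (0:ℝ) 1} (fun _ => (0:ℝ))
        (fun y => y 0 * y 1))
      (fun z => c * (z 0 ^ A' * z 1 ^ B' * z 2 ^ D) / (1 - z 2 ^ K)) := by
  refine (IsSemialgebraicFunOn.mul_holds
    (isSemialgebraicFunOn_const_of_isAlgebraic w3_isSemialgebraic_mergedBand hc)
    (isSemialgebraicFunOn_aeval_div_aeval w3_isSemialgebraic_mergedBand
      (MvPolynomial.X 0 ^ A' * MvPolynomial.X 1 ^ B' * MvPolynomial.X 2 ^ D)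
      (1 - MvPolynomial.X 2 ^ K) fun z hz => ?_)).congr fun z _ => ?_
  · have h := (w3_mergedBand_bounds hK A' B' D hz).1
    simp only [map_sub, map_one, map_pow, MvPolynomial.aeval_X]
    exact (h.1.trans_le h.2).ne'
  · simp only [Pi.mul_apply, map_sub, map_one, map_mul, map_pow, MvPolynomial.aeval_X]
    ring

/-- **Absolute convergence of the merged band integrand with a real coefficient** (`K ≥ 1`):
`c·z₀^{A'} z₁^{B'} z₂^D/(1 − z₂^K)` is integrable on the merged band
`{(z₀,z₁) ∈ (0,1)², 0 ≤ z₂ ≤ z₀z₁}`, by Tonelli along the last coordinate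
(`integrableOn_band_of_norm_le`): on the fibre over `(z₀,z₁) ∈ (0,1)²` the integrand is bounded by
`|c|/(1 − z₀z₁)` (`w3_mergedBand_bounds`), the fibre `[0, z₀z₁]` has length `≤ 1`, and
`|c|/(1 − z₀z₁)` is integrable on `(0,1)²` (Beukers' double integral for `ζ(2)`, the tree's
`BoxIntegral.integrableOn_box_one_div_one_sub_prod`). [cite: KontsevichZagier2001, §1.2 rule (2)] -/
theorem w3_integrableOn_mergedBandIntegrand {K : ℕ} (hK : 0 < K) (A' B' D : ℕ) (c : ℝ) :
    IntegrableOn (fun z : Fin 3 → ℝ => c * (z 0 ^ A' * z 1 ^ B' * z 2 ^ D) / (1 - z 2 ^ K))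
      (KZlog.band {y : Fin 2 → ℝ | ∀ i, y i ∈ Set.Ioo (0:ℝ) 1} (fun _ => (0:ℝ))
        (fun y => y 0 * y 1)) := by
  have hS : MeasurableSet {y : Fin 2 → ℝ | ∀ i, y i ∈ Set.Ioo (0:ℝ) 1} :=
    Beukers.measurableSet_cube 2
  have hB : MeasurableSet (KZlog.band {y : Fin 2 → ℝ | ∀ i, y i ∈ Set.Ioo (0:ℝ) 1}
      (fun _ => (0:ℝ)) (fun y => y 0 * y 1)) :=
    IsSemialgebraic.measurableSet_holds w3_isSemialgebraic_mergedBand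
  have hK1 : IntegrableOn (fun y : Fin 2 → ℝ => |c| * (1 / (1 - ∏ i, y i)))
      {y | ∀ i, y i ∈ Set.Ioo (0:ℝ) 1} :=
    (BoxIntegral.integrableOn_box_one_div_one_sub_prod (n := 2) le_rfl).const_mul |c|
  have hs0 : ∀ (y : Fin 2 → ℝ) (t : ℝ), (Fin.snoc y t : Fin 3 → ℝ) 0 = y 0 := fun _ _ => rfl
  have hs1 : ∀ (y : Fin 2 → ℝ) (t : ℝ), (Fin.snoc y t : Fin 3 → ℝ) 1 = y 1 := fun _ _ => rfl
  have hs2 : ∀ (y : Fin 2 → ℝ) (t : ℝ), (Fin.snoc y t : Fin 3 → ℝ) 2 = t := fun _ _ => rfl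
  refine integrableOn_band_of_norm_le hS (a := fun _ => (0:ℝ)) (b := fun y => y 0 * y 1)
    (M := fun y => |c| / (1 - y 0 * y 1)) (K := fun y => |c| * (1 / (1 - ∏ i, y i)))
    (fun y hy => (mul_pos (hy 0).1 (hy 1).1).le) hB (fun y t => KZlog.snoc_mem_band)
    (Measurable.aestronglyMeasurable (by fun_prop)) (fun y hy t ht => ?_) (fun y hy => ?_) hK1
  · -- the fibrewise bound `|c|/(1 − y₀y₁)`
    have hz : (Fin.snoc y t : Fin 3 → ℝ) ∈ KZlog.band {y : Fin 2 → ℝ | ∀ i, y i ∈ Set.Ioo (0:ℝ) 1}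
        (fun _ => (0:ℝ)) (fun y => y 0 * y 1) := KZlog.snoc_mem_band.2 ⟨hy, ht⟩
    have hb := w3_mergedBand_bounds hK A' B' D hz
    simp only [hs0, hs1, hs2] at hb ⊢
    rw [Real.norm_eq_abs, abs_div, abs_mul, abs_of_pos (hb.1.1.trans_le hb.1.2),
      abs_of_nonneg hb.2.1, mul_div_assoc]
    exact (mul_le_mul_of_nonneg_left (div_le_div₀ zero_le_one hb.2.2 hb.1.1 hb.1.2)
      (abs_nonneg c)).trans_eq (mul_one_div _ _)
  · -- the fibre has length `y₀y₁ ≤ 1`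
    have h0 := hy 0
    have h1 := hy 1
    have hlt : y 0 * y 1 < 1 := mul_lt_one_of_nonneg_of_lt_one_left h0.1.le h0.2 h1.2.le
    have hM : 0 ≤ |c| / (1 - y 0 * y 1) := div_nonneg (abs_nonneg c) (sub_pos.2 hlt).le
    rw [Fin.prod_univ_two, sub_zero, mul_one_div]
    exact mul_le_of_le_one_right hM (mul_le_one₀ h0.2.le h1.1.le h1.2.le)

/-- **The merged band representation with an algebraic coefficient exists** (`K ≥ 1`):
`[{(z₀,z₁) ∈ (0,1)², 0 ≤ z₂ ≤ z₀z₁}, c·z₀^{A'} z₁^{B'} z₂^D/(1 − z₂^K)]` is an integral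
representation for real algebraic `c` — the image of the box monomial
`c·x₀^A x₁^B x₂^D/(1 − x₀^K x₁^K x₂^K)` (`D < A`, `D < B`, `A' = A − D − 1`, `B' = B − D − 1`)
under the merge gadget `t = x₀x₁x₂`. [cite: KontsevichZagier2001, §1.2 rule (2)] -/
theorem w3_exists_mergedBandRep {K : ℕ} (hK : 0 < K) (A' B' D : ℕ) {c : ℝ} (hc : IsAlgebraic ℚ c) :
    ∃ R : IntegralRep 3,
      R.domain = KZlog.band {y : Fin 2 → ℝ | ∀ i, y i ∈ Set.Ioo (0:ℝ) 1} (fun _ => (0:ℝ))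
        (fun y => y 0 * y 1) ∧
      R.integrand = fun z => c * (z 0 ^ A' * z 1 ^ B' * z 2 ^ D) / (1 - z 2 ^ K) :=
  ⟨⟨_, _, w3_isSemialgebraic_mergedBand, w3_isSemialgebraicFunOn_mergedBandIntegrand hK A' B' D hc,
    w3_integrableOn_mergedBandIntegrand hK A' B' D c⟩, rfl, rfl⟩

/-! ## The registered sub-goal -/

/-- **Stub W5 (existence, dimension three; registered sub-goal `exists_reps3_box_band` of
stmt-KontsevichZagierPeriods-3869).** For `K ≥ 1` and a real algebraic coefficient `c`, the
weight-three level-`K` monomial box `[(0,1)³, c·x₀^A x₁^B x₂^D/(1 − x₀^K x₁^K x₂^K)]` and the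
merged band representation `[{(z₀,z₁) ∈ (0,1)², 0 ≤ z₂ ≤ z₀z₁}, c·z₀^{A'} z₁^{B'} z₂^D/(1 − z₂^K)]`
(its image under the merge gadget `t = x₀x₁x₂`, rule 2) exist as integral representations of the
Kontsevich–Zagier calculus, with literally these domains and integrands (semialgebraic data with
an algebraic constant; absolute convergence by domination by `|c|/(1 − x₀x₁x₂)` on the box, and by
Tonelli with the fibrewise bound `|c|/(1 − z₀z₁)` on the band).
[cite: KontsevichZagier2001, §1.2] -/
theorem exists_reps3_box_band (K : ℕ) (hK : 0 < K) (c : ℝ) (hc : IsAlgebraic ℚ c) :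
    (∀ (A B D : ℕ), ∃ N : IntegralRep 3, N.domain = {x | ∀ i, x i ∈ Set.Ioo (0:ℝ) 1} ∧
      N.integrand = fun x => c * (x 0 ^ A * x 1 ^ B * x 2 ^ D) / (1 - x 0 ^ K * x 1 ^ K * x 2 ^ K)) ∧
    (∀ (A' B' D : ℕ), ∃ R : IntegralRep 3,
      R.domain = KZlog.band {y : Fin 2 → ℝ | ∀ i, y i ∈ Set.Ioo (0:ℝ) 1} (fun _ => (0:ℝ))
        (fun y => y 0 * y 1) ∧
      R.integrand = fun z => c * (z 0 ^ A' * z 1 ^ B' * z 2 ^ D) / (1 - z 2 ^ K)) :=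
  ⟨fun A B D => w3_exists_box3Rep hK A B D hc, fun A' B' D => w3_exists_mergedBandRep hK A' B' D hc⟩

end Summit.KontsevichZagierPeriods.HurwitzMicroSectors.NormalFormPrinciple.PiBox.Weight3
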